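import Summits.BirchSwinnertonDyer.Rank1Residual.Additive.ChiBranchConstantTermOdd
import Mathlib.RingTheory.IntegralDomain
import HarnessLib

/-!
# The constant terms of ALL tame branches: `L_p(f,α,ω^i,0) = α⁻¹·∑_{a mod p} ω(a)^i [a/p]^±_f`
# (line V19 of the cell `b2b-bsdres`: the "other branch" term `o` made explicit)

HONEST FRAMING (cell `b2b-bsdres`, run/shared/lean/b2b/bsd-rank1-residual/, verbatim in every
file): the goal of the cell is to DELETE the COMBINATION-SHAPED residual classes of the
Birch–Swinnerton-Dyer formula for ALL analytic-rank `≤ 1` elliptic curves over `ℚ` — "full BSD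
formula for every rank `≤ 1` curve in class `C`" assembled STRICTLY from published theorems — so
that the rank-`≤ 1` remainder becomes exactly the CONSTRUCTION-SHAPED classes, which are TYPED
(missing-input `Prop`s), NOT attempted. This is not "finishing BSD". Seat additive-p4 (research route
on X3/X4); no label moves; nothing is booked here.

Theorems only (no `def`, no `sorry`, no named fact). The core theorem of line V19
(`XGordCyclotomicPrime.exists_padicVal_shaOrder_add_le`) carries the explicit per-pair term
`o = ∏_{i ∉ {0,(p−1)/2}} L_p(f,α,ω^i,0)`, the constant terms of the `p − 3` non-quadratic tame
branches of the Mazur–Swinnerton-Dyer measure of the good ordinary twist `V`. This file identifies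
EVERY such constant term with a finite modular-symbol sum (Mazur–Tate–Teitelbaum 1986, §I.13–I.14
with (10.1)), so that the per-pair certificate of `…bsdp_of_certificate_of_facts` is a statement
about `∑_{a mod p} ω(a)^i [a/p]^±_f` (computed exactly by the census job from modular symbols):

* `sum_teichRep_pow_eq_zero` — the Teichmüller character sum `∑_{a ∈ (ℤ/p)ˣ} ω(a)^i = 0` for
  `(p − 1) ∤ i` (`p` odd): reindex by the bijection `ω : (ℤ/p)ˣ ≃ μ_{p−1}(ℤ_p)` and apply
  `sum_hom_units_eq_zero` to the non-trivial homomorphism `ξ ↦ ξ^i` of the cyclic group `μ_{p−1}`;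
* `constantCoeff_padicLFunctionBranch_eq_sum` — for `(p−1) ∤ i`:
  `L_p(f,α,ω^i,0) = α⁻¹·∑_{a ∈ (ℤ/p)ˣ} ω(a)^i [a/p]⁺_f` (the measure `μ(a + pℤ_p) = α⁻¹[a/p]⁺ − α⁻²[0]⁺`,
  the second term killed by the character sum) — generalises `constantCoeff_padicLFunctionBranch_half`
  (`i = (p−1)/2`, Euler's criterion);
* `constantCoeff_padicLFunctionMinusBranch_eq_sum` — for EVERY `i`:
  `L⁻_p(f,α,ω^i,0) = α⁻¹·∑_{a ∈ (ℤ/p)ˣ} ω(a)^i [a/p]⁻_f` (`[a]⁻ = [0]⁻ = 0`, no character sum needed) —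
  generalises `constantCoeff_padicLFunctionMinusBranch_half`.

References: Mazur–Tate–Teitelbaum 1986 [MazurTateTeitelbaum1986Invent] §I.10 (10.1), §I.13, §I.14;
Washington, *Cyclotomic Fields* §5.1.
-/

noncomputable section

open scoped Classical MatrixGroups ModularForm

open CongruenceSubgroup WeierstrassCurve Literature.NumberTheory.EllipticCurves
  Literature.NumberTheory.EllipticCurves.ModularForms
  Literature.NumberTheory.EllipticCurves.Rank1Residual

namespace Summit.BirchSwinnertonDyer.Rank1Residual.Additive

section General

variable (p : ℕ) [hp : Fact p.Prime]

/-- **The Teichmüller character sum vanishes off the trivial character**: for `p` odd and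
`(p − 1) ∤ i`, `∑_{a ∈ (ℤ/p)ˣ} ω(a)^i = 0` in `ℚ_p`. Proof: `ω` is a bijection
`(ℤ/p^{e₀})ˣ → μ_τ(ℤ_p)` (`teichReduce_bijective`), `τ = p − 1`; the map `ξ ↦ ξ^i` is a monoid
homomorphism `μ_τ(ℤ_p) → ℚ_p` which is non-trivial at a primitive `τ`-th root of unity
(`exists_isPrimitiveRoot_torsionOrder`); Mathlib `sum_hom_units_eq_zero`. [folklore] -/
theorem sum_teichRep_pow_eq_zero (hp2 : p ≠ 2) {i : ℕ} (hi : ¬ (p - 1) ∣ i) :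
    ∑ a : (ZMod (p ^ cyclotomicExponent p))ˣ,
      ((((teichRep p a : rootsOfUnity (torsionOrder p) ℤ_[p]) : ℤ_[p]ˣ) : ℤ_[p]) : ℚ_[p]) ^ i = 0 := by
  classical
  haveI := neZero_torsionOrder p
  haveI : Fintype (rootsOfUnity (torsionOrder p) ℤ_[p]) := Fintype.ofFinite _
  have hτ : torsionOrder p = p - 1 := by rw [torsionOrder_eq, if_neg hp2]
  -- the homomorphism `ξ ↦ ξ^i` on `μ_τ(ℤ_p)`, valued in `ℚ_p`
  let φ : rootsOfUnity (torsionOrder p) ℤ_[p] →* ℚ_[p] :=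
    (powMonoidHom i).comp (((Units.coeHom ℚ_[p]).comp
      (Units.map (PadicInt.Coe.ringHom : ℤ_[p] →+* ℚ_[p]).toMonoidHom)).comp
        (rootsOfUnity (torsionOrder p) ℤ_[p]).subtype)
  have hφ : ∀ ξ : rootsOfUnity (torsionOrder p) ℤ_[p],
      φ ξ = ((((ξ : ℤ_[p]ˣ) : ℤ_[p]) : ℚ_[p])) ^ i := fun ξ ↦ rfl
  -- `φ` is non-trivial: a primitive `τ`-th root of unity `ζ` has `ζ^i ≠ 1`
  have hφ1 : φ ≠ 1 := by
    obtain ⟨ζ, hζ⟩ := exists_isPrimitiveRoot_torsionOrder p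
    intro h1
    have hζu : IsUnit ζ := hζ.isUnit (NeZero.ne _)
    set ξ : rootsOfUnity (torsionOrder p) ℤ_[p] :=
      ⟨hζu.unit, (mem_rootsOfUnity _ _).mpr (Units.ext (by
        rw [Units.val_pow_eq_pow_val, IsUnit.unit_spec, hζ.pow_eq_one, Units.val_one]))⟩ with hξ
    have h := congrArg (fun ψ : rootsOfUnity (torsionOrder p) ℤ_[p] →* ℚ_[p] ↦ ψ ξ) h1
    simp only [MonoidHom.one_apply] at h
    rw [hφ ξ] at h
    have hval : ((ξ : ℤ_[p]ˣ) : ℤ_[p]) = ζ := IsUnit.unit_spec hζu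
    rw [hval, ← PadicInt.coe_pow, ← PadicInt.coe_one] at h
    have hdvd := (hζ.pow_eq_one_iff_dvd i).mp (PadicInt.ext h)
    rw [hτ] at hdvd
    exact hi hdvd
  -- reindex along the Teichmüller bijection and sum the non-trivial character
  have hbij : Function.Bijective (teichRep p) :=
    (Equiv.ofBijective (teichReduce p) (teichReduce_bijective p)).symm.bijective
  rw [show (∑ a : (ZMod (p ^ cyclotomicExponent p))ˣ,
      ((((teichRep p a : rootsOfUnity (torsionOrder p) ℤ_[p]) : ℤ_[p]ˣ) : ℤ_[p]) : ℚ_[p]) ^ i) =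
      ∑ ξ : rootsOfUnity (torsionOrder p) ℤ_[p], φ ξ from
    Fintype.sum_bijective (teichRep p) hbij _ _ (fun a ↦ (hφ (teichRep p a)).symm)]
  exact sum_hom_units_eq_zero φ hφ1

/-- **The constant term of the `ω^i`-branch for `(p−1) ∤ i`** (Mazur–Tate–Teitelbaum 1986 §I.14,
`p` odd): for `V/ℚ` globally minimal, good ordinary at `p`, with newform `f` and unit root `α`,
`L_p(f,α,ω^i,0) = α⁻¹ · ∑_{a ∈ (ℤ/p)ˣ} ω(a)^i [a/p]⁺_f` — the measure of a class mod `p` is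
`α⁻¹[a/p]⁺ − α⁻²[0]⁺` (MTT (10.1)), and `∑_a ω(a)^i = 0` kills the second term
(`sum_teichRep_pow_eq_zero`). For `i = (p−1)/2` this is `constantCoeff_padicLFunctionBranch_half`
(there `ω^{(p−1)/2} = (·/p)`). [cite: MazurTateTeitelbaum1986Invent, §I.13–I.14] -/
theorem constantCoeff_padicLFunctionBranch_eq_sum (hp2 : p ≠ 2) {N : ℕ} [NeZero N]
    {f : CuspForm (Gamma0 N) 2} (V : WeierstrassCurve ℚ) [V.IsElliptic] [V.IsGloballyMinimal]
    (hord : IsOrdinaryAt V p) (hf : IsNewformOf V f) {i : ℕ} (hi : ¬ (p - 1) ∣ i) :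
    PowerSeries.constantCoeff (padicLFunctionBranch f (unitRoot V p : ℚ_[p]) i) =
      (unitRoot V p : ℚ_[p])⁻¹ * ∑ a : (ZMod (p ^ cyclotomicExponent p))ˣ,
        ((((teichRep p a : rootsOfUnity (torsionOrder p) ℤ_[p]) : ℤ_[p]ˣ) : ℤ_[p]) : ℚ_[p]) ^ i *
          (ratPlusSymbol f (((a : ZMod (p ^ cyclotomicExponent p)).val : ℚ) / p) : ℚ_[p]) := by
  classical
  have he : cyclotomicExponent p = 0 + 1 := by rw [zero_add]; exact cyclotomicExponent_eq_one p hp2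
  set α : ℚ_[p] := (unitRoot V p : ℚ_[p]) with hα
  rw [constantCoeff_padicLFunctionBranch_eq (msdMeasure_distribution_of_isNewformOf hord hf) i]
  have hsummand : ∀ a : (ZMod (p ^ cyclotomicExponent p))ˣ,
      msdMeasure f α (cyclotomicExponent p) (a : ZMod (p ^ cyclotomicExponent p)) *
          ((((teichRep p a : rootsOfUnity (torsionOrder p) ℤ_[p]) : ℤ_[p]ˣ) : ℤ_[p]) : ℚ_[p]) ^ i =
        α⁻¹ * (((((teichRep p a : rootsOfUnity (torsionOrder p) ℤ_[p]) : ℤ_[p]ˣ) : ℤ_[p]) : ℚ_[p]) ^ i *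
            (ratPlusSymbol f (((a : ZMod (p ^ cyclotomicExponent p)).val : ℚ) / p) : ℚ_[p])) -
          α⁻¹ ^ 2 * (ratPlusSymbol f 0 : ℚ_[p]) *
            ((((teichRep p a : rootsOfUnity (torsionOrder p) ℤ_[p]) : ℤ_[p]ˣ) : ℤ_[p]) : ℚ_[p]) ^ i := by
    intro a
    have hper : ratPlusSymbol f (((a : ZMod (p ^ cyclotomicExponent p)).val : ℚ) / (p : ℚ) ^ 0) =
        ratPlusSymbol f 0 := by
      rw [pow_zero, div_one, ← ratPlusSymbol_add_intCast_eq f 0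
        ((a : ZMod (p ^ cyclotomicExponent p)).val : ℤ)]
      push_cast
      rw [zero_add]
    rw [msdMeasure_of_eq_succ f α he, hper, zero_add, pow_one, pow_one]
    ring
  rw [Fintype.sum_congr _ _ hsummand, Finset.sum_sub_distrib, ← Finset.mul_sum, ← Finset.mul_sum,
    sum_teichRep_pow_eq_zero p hp2 hi, mul_zero, sub_zero]

/-- **The constant term of the ODD `ω^i`-branch, every `i`** (Mazur–Tate–Teitelbaum 1986 §I.13–I.14,
`p` odd): `L⁻_p(f,α,ω^i,0) = α⁻¹ · ∑_{a ∈ (ℤ/p)ˣ} ω(a)^i [a/p]⁻_f` for the newform `f` of a good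
ordinary `V` and `α = unitRoot V p`: `μ⁻(a + pℤ_p) = α⁻¹[a/p]⁻ − α⁻²[a]⁻ = α⁻¹[a/p]⁻` since
`[a]⁻ = [0]⁻ = 0`. For `i = (p−1)/2` this is `constantCoeff_padicLFunctionMinusBranch_half`.
[cite: MazurTateTeitelbaum1986Invent, §I.13–I.14] -/
theorem constantCoeff_padicLFunctionMinusBranch_eq_sum (hp2 : p ≠ 2) {N : ℕ} [NeZero N]
    {f : CuspForm (Gamma0 N) 2} (V : WeierstrassCurve ℚ) [V.IsElliptic] [V.IsGloballyMinimal]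
    (hord : IsOrdinaryAt V p) (hf : IsNewformOf V f) (i : ℕ) :
    PowerSeries.constantCoeff (padicLFunctionMinusBranch f (unitRoot V p : ℚ_[p]) i) =
      (unitRoot V p : ℚ_[p])⁻¹ * ∑ a : (ZMod (p ^ cyclotomicExponent p))ˣ,
        ((((teichRep p a : rootsOfUnity (torsionOrder p) ℤ_[p]) : ℤ_[p]ˣ) : ℤ_[p]) : ℚ_[p]) ^ i *
          (ratMinusSymbol f (((a : ZMod (p ^ cyclotomicExponent p)).val : ℚ) / p) : ℚ_[p]) := by
  classical
  have he : cyclotomicExponent p = 0 + 1 := by rw [zero_add]; exact cyclotomicExponent_eq_one p hp2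
  set α : ℚ_[p] := (unitRoot V p : ℚ_[p]) with hα
  rw [constantCoeff_padicLFunctionMinusBranch_eq (msdMinusMeasure_distribution_of_isNewformOf p V hord hf)
    i]
  have hsummand : ∀ a : (ZMod (p ^ cyclotomicExponent p))ˣ,
      msdMinusMeasure f α (cyclotomicExponent p) (a : ZMod (p ^ cyclotomicExponent p)) *
          ((((teichRep p a : rootsOfUnity (torsionOrder p) ℤ_[p]) : ℤ_[p]ˣ) : ℤ_[p]) : ℚ_[p]) ^ i =
        α⁻¹ * (((((teichRep p a : rootsOfUnity (torsionOrder p) ℤ_[p]) : ℤ_[p]ˣ) : ℤ_[p]) : ℚ_[p]) ^ i *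
            (ratMinusSymbol f (((a : ZMod (p ^ cyclotomicExponent p)).val : ℚ) / p) : ℚ_[p])) := by
    intro a
    have hzero : ratMinusSymbol f (((a : ZMod (p ^ cyclotomicExponent p)).val : ℚ) / (p : ℚ) ^ 0) = 0 := by
      rw [pow_zero, div_one]
      have h := ratMinusSymbol_add_intCast f 0 ((a : ZMod (p ^ cyclotomicExponent p)).val : ℤ)
      rw [ratMinusSymbol_zero, zero_add] at h
      exact_mod_cast h
    rw [msdMinusMeasure_of_eq_succ f α he, hzero, zero_add, pow_one]
    push_cast
    ring
  rw [Fintype.sum_congr _ _ hsummand, ← Finset.mul_sum]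

end General

end Summit.BirchSwinnertonDyer.Rank1Residual.Additive

end
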